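import Mathlib

/-!
# `WeightedInvariant.LocalWeightedDrop`, sub-stub N4″: LABELS of monic double points — scaled Newton set, odd points, vertices,
# well-preparedness, the polygon invariants `δ α β γ⁻ ε ζ`, and the label transports (definitions, piece T-L of the N4″ plan)

Crux item stmt-ResolutionOfSingularities-8899 `LocalWeightedDrop` (route `ResolutionOfSingularities/WeightedInvariant`), door
`WeightedConstruction` stmt-ResolutionOfSingularities-0571.  [OURS · L1 W4.3, chain w43, lead prover.  Objects the engine line posits for
the termination proof of the descent game (`N4PRIME-PLAN.md`, evidence on stmt-8899); the MODEL is Cossart–Jannsen–Saito LNM 2270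
Def. 8.2/8.13/8.15 and Def. 11.1 specialised to `J = (y² + A₁y + A₀)`, `μ = 2`, `R = k[[u₁,u₂,y]]`, `char k = 2`; nothing here is a
statement of any manuscript.]

A LABEL is a pair `(A₀, A₁)` of series in `k[[u₁,u₂]]` read in the given coordinates; the germ is `y² + A₁y + A₀`.  Everything is SCALED
BY 2 so that all invariants are natural numbers:

* `newtonSet A₀ A₁ ⊂ ℕ²` — the exponents of `A₀` together with TWICE the exponents of `A₁` (= `2 ·` the generating points
  `e/(μ − j)` of Hironaka's polygon `Δ(f; u; y)`, `μ = 2`);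
* `IsOdd` — a point that is (twice) an exponent of `A₁`, or an exponent of `A₀` with an odd coordinate: exactly the points that NO re-centring
  `y ↦ y + ψ(u)` can dissolve in characteristic `2` (`(A₀, A₁) ↦ (A₀ + A₁ψ + ψ², A₁)`, `ψ²` has even exponents only); `IsVertex` — exposed
  by a positive integral weight; `WellPrepared` — every vertex is odd (CJS Def. 8.15 "well prepared": no solvable vertex);
* `deltaL, alphaL, betaL, gammaL, epsL, zetaL` — `2δ, 2α, 2β, 2γ⁻, 2ε, 2ζ` of CJS Def. 11.1 as infima over the (scaled) Newton set;
* `IsPermissibleOne/Two` — `u₁ ∣ A₁ ∧ u₁² ∣ A₀` (the curve `V(y, u₁)` is permissible), resp. for `u₂`;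
* the LABEL TRANSPORTS, coefficientwise: `blowOne c A` = `A(u₁, u₁u₂)/u₁^c` (point blow-up, origin of the `u₁`-chart; `c = 2` on `A₀`,
  `c = 1` on `A₁`), `blowTwo c A` (origin of the `u₂`-chart), `divOne c A = A/u₁^c`, `divTwo c A` (curve blow-ups), `recentre ψ A₀ A₁`,
  and the `u₂`-SHEAR `shear h A = A(u₁, u₂ + u₁h)` (CJS Lemma 13.6's change `ũ₂ = u₂ − φu₁`; in characteristic 2 the pair in the new
  coordinates `(u₁, ũ₂)` is `shear h` of the old one).
Only definitions and their unfoldings; the laws (exact images of the Newton set, persistence of well-preparedness, `β′ = γ⁻ ≤ β`, …) are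
pieces T-3/T-1 of the plan.
-/

set_option linter.dupNamespace false -- mandated namespace of this single-conjunct summit

noncomputable section

namespace Summit.ResolutionOfSingularities.ResolutionOfSingularities.Theorems

namespace MonicDescent

open MvPowerSeries

variable {k : Type} [Field k]

/-! ## The scaled Newton set, odd points, vertices, well-preparedness -/

/-- The SCALED NEWTON SET of a label: exponents of `A₀`, and twice the exponents of `A₁`. -/
def newtonSet (A₀ A₁ : MvPowerSeries (Fin 2) k) : Set (Fin 2 →₀ ℕ) :=
  {P | coeff P A₀ ≠ 0} ∪ {P | ∃ e : Fin 2 →₀ ℕ, P = 2 • e ∧ coeff e A₁ ≠ 0}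

/-- An ODD point of a label: twice an exponent of `A₁`, or an exponent of `A₀` with an odd coordinate.  (The non-solvable points: the
vertex initial form `y² + a u^{P/2} y + b u^P` is a square iff `a = 0` and `P ∈ (2ℕ)²`.) -/
def IsOdd (A₀ A₁ : MvPowerSeries (Fin 2) k) (P : Fin 2 →₀ ℕ) : Prop :=
  (∃ e : Fin 2 →₀ ℕ, P = 2 • e ∧ coeff e A₁ ≠ 0) ∨ (coeff P A₀ ≠ 0 ∧ ∃ i, ¬ 2 ∣ P i)

/-- A VERTEX of a point set `N ⊂ ℕ²`: a point of `N` at which some positive integral weight is uniquely minimised over `N`. -/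
def IsVertex (N : Set (Fin 2 →₀ ℕ)) (P : Fin 2 →₀ ℕ) : Prop :=
  P ∈ N ∧ ∃ w : Fin 2 → ℕ, (∀ i, 0 < w i) ∧ ∀ Q ∈ N, Q ≠ P → Finsupp.weight w P < Finsupp.weight w Q

/-- A WELL-PREPARED label: every vertex of its scaled Newton set is odd (CJS Def. 8.15: no solvable vertex). -/
def WellPrepared (A₀ A₁ : MvPowerSeries (Fin 2) k) : Prop :=
  ∀ P, IsVertex (newtonSet A₀ A₁) P → IsOdd A₀ A₁ P

/-! ## The scaled polygon invariants (CJS Def. 11.1, times 2; junk value `0` on empty sets) -/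

/-- `2δ`: the least `P₀ + P₁` over the Newton set. -/
noncomputable def deltaL (N : Set (Fin 2 →₀ ℕ)) : ℕ := sInf ((fun P => P 0 + P 1) '' N)

/-- `2α`: the least first coordinate over the Newton set. -/
noncomputable def alphaL (N : Set (Fin 2 →₀ ℕ)) : ℕ := sInf ((fun P => P 0) '' N)

/-- `2β`: the least second coordinate on the leftmost column `P₀ = 2α`. -/
noncomputable def betaL (N : Set (Fin 2 →₀ ℕ)) : ℕ := sInf ((fun P => P 1) '' {P | P ∈ N ∧ P 0 = alphaL N})

/-- `2γ⁻`: the least second coordinate on the `δ`-face `P₀ + P₁ = 2δ`. -/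
noncomputable def gammaL (N : Set (Fin 2 →₀ ℕ)) : ℕ := sInf ((fun P => P 1) '' {P | P ∈ N ∧ P 0 + P 1 = deltaL N})

/-- `2ε`: the least second coordinate over the Newton set. -/
noncomputable def epsL (N : Set (Fin 2 →₀ ℕ)) : ℕ := sInf ((fun P => P 1) '' N)

/-- `2ζ`: the least first coordinate on the lowest row `P₁ = 2ε`. -/
noncomputable def zetaL (N : Set (Fin 2 →₀ ℕ)) : ℕ := sInf ((fun P => P 0) '' {P | P ∈ N ∧ P 1 = epsL N})

/-! ## Permissibility of the axis curves -/

/-- `V(y, u₁)` is PERMISSIBLE for the label: `u₁ ∣ A₁` and `u₁² ∣ A₀` (all points of the scaled Newton set have `P₀ ≥ 2`). -/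
def IsPermissibleOne (A₀ A₁ : MvPowerSeries (Fin 2) k) : Prop :=
  (∀ d, coeff d A₀ ≠ 0 → 2 ≤ d 0) ∧ (∀ d, coeff d A₁ ≠ 0 → 1 ≤ d 0)

/-- `V(y, u₂)` is PERMISSIBLE for the label: `u₂ ∣ A₁` and `u₂² ∣ A₀`. -/
def IsPermissibleTwo (A₀ A₁ : MvPowerSeries (Fin 2) k) : Prop :=
  (∀ d, coeff d A₀ ≠ 0 → 2 ≤ d 1) ∧ (∀ d, coeff d A₁ ≠ 0 → 1 ≤ d 1)

/-! ## Label transports -/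

/-- RE-CENTRING `y ↦ y + ψ`: `(A₀, A₁) ↦ (A₀ + A₁ψ + ψ², A₁ + 2ψ)`; in characteristic 2 the second component is `A₁`. -/
def recentre {m : ℕ} (ψ A₀ A₁ : MvPowerSeries (Fin m) k) : MvPowerSeries (Fin m) k × MvPowerSeries (Fin m) k :=
  (A₀ + A₁ * ψ + ψ ^ 2, A₁ + 2 * ψ)

/-- POINT BLOW-UP, origin of the `u₁`-chart, divided by `u₁^c`: `A(u₁, u₁u₂)/u₁^c`, coefficientwise
(`u^e ↦ u₁^{e₀ + e₁ − c} u₂^{e₁}`; monomials with `e₀ + e₁ < c` are dropped — there are none when `ord A ≥ c`). -/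
def blowOne (c : ℕ) (A : MvPowerSeries (Fin 2) k) : MvPowerSeries (Fin 2) k :=
  fun d => if d 1 ≤ d 0 + c then coeff (Finsupp.single 0 (d 0 + c - d 1) + Finsupp.single 1 (d 1)) A else 0

/-- POINT BLOW-UP, origin of the `u₂`-chart, divided by `u₂^c`: `A(u₁u₂, u₂)/u₂^c` (`u^e ↦ u₁^{e₀} u₂^{e₀ + e₁ − c}`). -/
def blowTwo (c : ℕ) (A : MvPowerSeries (Fin 2) k) : MvPowerSeries (Fin 2) k :=
  fun d => if d 0 ≤ d 1 + c then coeff (Finsupp.single 0 (d 0) + Finsupp.single 1 (d 1 + c - d 0)) A else 0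

/-- CURVE BLOW-UP of `V(y, u₁)`: `A/u₁^c` coefficientwise (`u^e ↦ u^{e − (c,0)}`; exact when `u₁^c ∣ A`). -/
def divOne (c : ℕ) (A : MvPowerSeries (Fin 2) k) : MvPowerSeries (Fin 2) k :=
  fun d => coeff (d + Finsupp.single 0 c) A

/-- CURVE BLOW-UP of `V(y, u₂)`: `A/u₂^c` coefficientwise. -/
def divTwo (c : ℕ) (A : MvPowerSeries (Fin 2) k) : MvPowerSeries (Fin 2) k :=
  fun d => coeff (d + Finsupp.single 1 c) A

/-- The `u₂`-SHEAR by `h ∈ k[[u₁,u₂]]`: `A(u₁, u₂ + u₁h)`.  Reading a label in the new coordinate `ũ₂ = u₂ + u₁h` (CJS Lemma 13.6, any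
`h`; the plan uses `h ∈ k[[u₁]]`) replaces `(A₀, A₁)` by `(shear h A₀, shear h A₁)` in characteristic `2`. -/
noncomputable def shear (h A : MvPowerSeries (Fin 2) k) : MvPowerSeries (Fin 2) k :=
  MvPowerSeries.subst (fun i : Fin 2 => if i = 0 then X 0 else X 1 + X 0 * h) A

/-! ## Unfoldings -/

/-- Membership in the scaled Newton set. -/
theorem mem_newtonSet_iff (A₀ A₁ : MvPowerSeries (Fin 2) k) (P : Fin 2 →₀ ℕ) :
    P ∈ newtonSet A₀ A₁ ↔ coeff P A₀ ≠ 0 ∨ ∃ e : Fin 2 →₀ ℕ, P = 2 • e ∧ coeff e A₁ ≠ 0 := Iff.rfl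

/-- An odd point lies in the Newton set. -/
theorem IsOdd.mem_newtonSet {A₀ A₁ : MvPowerSeries (Fin 2) k} {P : Fin 2 →₀ ℕ} (h : IsOdd A₀ A₁ P) :
    P ∈ newtonSet A₀ A₁ := by
  rcases h with h | ⟨h, -⟩
  · exact Or.inr h
  · exact Or.inl h

/-- Coefficients of `blowOne`. -/
theorem coeff_blowOne (c : ℕ) (A : MvPowerSeries (Fin 2) k) (d : Fin 2 →₀ ℕ) :
    coeff d (blowOne c A) =
      if d 1 ≤ d 0 + c then coeff (Finsupp.single 0 (d 0 + c - d 1) + Finsupp.single 1 (d 1)) A else 0 := by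
  rfl

/-- Coefficients of `blowTwo`. -/
theorem coeff_blowTwo (c : ℕ) (A : MvPowerSeries (Fin 2) k) (d : Fin 2 →₀ ℕ) :
    coeff d (blowTwo c A) =
      if d 0 ≤ d 1 + c then coeff (Finsupp.single 0 (d 0) + Finsupp.single 1 (d 1 + c - d 0)) A else 0 := by
  rfl

/-- Coefficients of `divOne`. -/
theorem coeff_divOne (c : ℕ) (A : MvPowerSeries (Fin 2) k) (d : Fin 2 →₀ ℕ) :
    coeff d (divOne c A) = coeff (d + Finsupp.single 0 c) A := by
  rfl

/-- Coefficients of `divTwo`. -/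
theorem coeff_divTwo (c : ℕ) (A : MvPowerSeries (Fin 2) k) (d : Fin 2 →₀ ℕ) :
    coeff d (divTwo c A) = coeff (d + Finsupp.single 1 c) A := by
  rfl

/-- The shear substitution is substitutable (zero constant terms). -/
theorem hasSubst_shear (h : MvPowerSeries (Fin 2) k) :
    MvPowerSeries.HasSubst (fun i : Fin 2 => if i = 0 then (X 0 : MvPowerSeries (Fin 2) k) else X 1 + X 0 * h) :=
  MvPowerSeries.hasSubst_of_constantCoeff_zero fun i => by
    fin_cases i <;> simp [constantCoeff_X]

/-- The first component of `recentre`. -/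
theorem recentre_fst {m : ℕ} (ψ A₀ A₁ : MvPowerSeries (Fin m) k) : (recentre ψ A₀ A₁).1 = A₀ + A₁ * ψ + ψ ^ 2 := rfl

end MonicDescent

end Summit.ResolutionOfSingularities.ResolutionOfSingularities.Theorems

end
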